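import Summits.ValiantsHypothesis.ValiantsHypothesis.Theorems.SymPencilPerFourInnerRankRows
import Summits.ValiantsHypothesis.ValiantsHypothesis.Theorems.SymPencilPerFourInnerRankPairs

/-!
# Route `SymPencil` — inner rank of the `2 | 2` row split of `per_4`, PEELED case: transporting a
# reduced family along a simultaneous coordinate permutation (`--supports`
# stmt-ValiantsHypothesis-5674 `SdcSuperquadratic`; (8,8) column, memo
# `NOTE-p6g16-5674-R2-peeled-ten.md` §2, "S₄ acts on all four slots")

`per (a; b; y; z)` is invariant under a permutation `π` of the coordinates applied to all four rows
(`Matrix.permanent_permute_rows`).  Hence the data of a reduced family (`…InnerRankReducedFamily`: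
weights, joint identity, scalar outer blocks `v₀, v₀'`, the peeled witness, and the row-`𝟙`
coefficients `h` of the `a`-block) are transported to the family `t'_r((a,b),(y,z)) :=
t_r((a∘π, b∘π),(y∘π, z∘π))`, with the same `v₀, v₀'` and `h` replaced by `h ∘ π⁻¹`
(`transport_perm`).  This lets the peeled-case theorems assume a pattern of `h` sits in fixed
positions.  Honest framing: bookkeeping lemma; no cell closes; `27 ≤ sdc(per_4) ≤ 29`, the crux and
`VP ≠ VNP` untouched.  No definitions, no named facts. [folklore]
-/

noncomputable section

-- single-conjunct layout: Sub = Summit, duplicated namespace component intended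
set_option linter.dupNamespace false

namespace Summit.ValiantsHypothesis.ValiantsHypothesis.Theorems.SymPencilPerFourPeeledTransport

open Matrix Finset

universe u v

variable {K : Type u} [Field K]

/-- `per` is invariant under a simultaneous permutation of the coordinates of its four rows.
[folklore] -/
theorem per_comp_perm (π : Equiv.Perm (Fin 4)) (a b y z : Fin 4 → K) :
    (Matrix.of ![a ∘ π, b ∘ π, y ∘ π, z ∘ π]).permanent = (Matrix.of ![a, b, y, z]).permanent := by
  have : Matrix.of ![a ∘ π, b ∘ π, y ∘ π, z ∘ π] = (Matrix.of ![a, b, y, z]).submatrix id π := by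
    ext i j; fin_cases i <;> rfl
  rw [this, Matrix.permanent_permute_rows]

/-- **Transport of a reduced family along a coordinate permutation.**  See the module
docstring. [folklore] -/
theorem transport_perm {κ : Type v} [Fintype κ] (π : Equiv.Perm (Fin 4)) (c : κ → K)
    (t : κ → (((Fin 4 → K) × (Fin 4 → K)) →ₗ[K] ((Fin 4 → K) × (Fin 4 → K)) →ₗ[K] K))
    (hJ : ∀ a b y₂ y₃ : Fin 4 → K,
      ∑ r, c r * (t r (a, b) (y₂, y₃)) ^ 2 = (Matrix.of ![a, b, y₂, y₃]).permanent)
    (v₀ v₀' : κ → K) (hv₀ : ∀ (a x : Fin 4 → K), ∃ s : K, (fun r => t r (a, 0) (x, 0)) = s • v₀)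
    (hv₀' : ∀ (b x : Fin 4 → K), ∃ s : K, (fun r => t r (0, b) (0, x)) = s • v₀')
    (hpeel : ∃ a b y z : Fin 4 → K, ∑ r, c r * t r (a, 0) (y, 0) * t r (0, b) (0, z) ≠ 0)
    (h : Fin 4 → K) (hh : ∀ k r, t r ((fun _ => 1), 0) (Pi.single k 1, 0) = h k * v₀ r) :
    ∃ t' : κ → (((Fin 4 → K) × (Fin 4 → K)) →ₗ[K] ((Fin 4 → K) × (Fin 4 → K)) →ₗ[K] K),
      (∀ a b y₂ y₃ : Fin 4 → K,
        ∑ r, c r * (t' r (a, b) (y₂, y₃)) ^ 2 = (Matrix.of ![a, b, y₂, y₃]).permanent) ∧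
      (∀ (a x : Fin 4 → K), ∃ s : K, (fun r => t' r (a, 0) (x, 0)) = s • v₀) ∧
      (∀ (b x : Fin 4 → K), ∃ s : K, (fun r => t' r (0, b) (0, x)) = s • v₀') ∧
      (∃ a b y z : Fin 4 → K, ∑ r, c r * t' r (a, 0) (y, 0) * t' r (0, b) (0, z) ≠ 0) ∧
      (∀ k r, t' r ((fun _ => 1), 0) (Pi.single k 1, 0) = h (π.symm k) * v₀ r) := by
  classical
  -- precomposition with `π` on both components
  let L : ((Fin 4 → K) × (Fin 4 → K)) →ₗ[K] ((Fin 4 → K) × (Fin 4 → K)) :=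
    (LinearMap.funLeft K K π).prodMap (LinearMap.funLeft K K π)
  have hL : ∀ a b : Fin 4 → K, L (a, b) = (a ∘ π, b ∘ π) := fun a b => rfl
  let t' : κ → (((Fin 4 → K) × (Fin 4 → K)) →ₗ[K] ((Fin 4 → K) × (Fin 4 → K)) →ₗ[K] K) :=
    fun r => (t r).compl₁₂ L L
  have ht' : ∀ r (a b y z : Fin 4 → K), t' r (a, b) (y, z) = t r (a ∘ π, b ∘ π) (y ∘ π, z ∘ π) :=
    fun r a b y z => rfl
  have z0 : ((0 : Fin 4 → K) ∘ π) = 0 := rfl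
  have one0 : ((fun _ => (1 : K)) ∘ π) = fun _ => (1 : K) := rfl
  refine ⟨t', fun a b y₂ y₃ => ?_, fun a x => ?_, fun b x => ?_, ?_, fun k r => ?_⟩
  · simp only [ht']
    rw [hJ, per_comp_perm]
  · obtain ⟨s, hs⟩ := hv₀ (a ∘ π) (x ∘ π)
    exact ⟨s, by simpa only [ht', z0] using hs⟩
  · obtain ⟨s, hs⟩ := hv₀' (b ∘ π) (x ∘ π)
    exact ⟨s, by simpa only [ht', z0] using hs⟩
  · obtain ⟨a, b, y, z, hne⟩ := hpeel
    refine ⟨a ∘ π.symm, b ∘ π.symm, y ∘ π.symm, z ∘ π.symm, ?_⟩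
    have hc : ∀ w : Fin 4 → K, (w ∘ π.symm) ∘ π = w := fun w => by
      funext i; simp
    simpa only [ht', z0, hc] using hne
  · rw [ht', one0, z0, SymPencilPerFourInnerRankPairs.single_comp_perm]
    exact hh (π.symm k) r

end Summit.ValiantsHypothesis.ValiantsHypothesis.Theorems.SymPencilPerFourPeeledTransport

end
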